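import Summits.QuantumFields.QCD.Theses.WilsonQuarkChessboard
import Summits.QuantumFields.QCD.Theses.GradientFlowSpecies
import Literature.MathematicalPhysics.QuantumFieldTheory.MassGapToLatticeClustering

/-!
# Crux `WilsonQuarkChessboard.MassiveBridge` (stmt-QuantumFields-17577), line `registered`, stub
`stub_speciesClusteringLaw` — structural lemmas (helper file, `--supports`)

The gen-2 skeleton `Cruxes/MassiveBridge/Lines/birth.lean` cuts the crux into three laws; the third,
`SpeciesClusteringLawStmt`, is NEW as a statement (no existing item): for `N_f ∈ {2,3}`, every regularisation
`reg` with `HasMassScaling` carrying full continuum data above an offset `M₀ ≥ 0` has a threshold `M₂ ≥ M₀` above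
which, for every tuple and every DATA-CARRYING species renormalisation `(z, shift, T)`
(`IsQCDAlong (reg.scheme m z shift) T`), the lattice theories cluster the smeared species correlators in
Cauchy–Schwarz form at some rate `Δ > 0` (`QCDScheme.HasSpeciesCSClustering`).  It is an open problem (it contains
the heavy-quark lattice QCD gap seen by the species channels).  This file records, sorry-free and with all
statements INLINED over the Statement's vocabulary (the skeleton's `def`s live in a crux workfile and are not
importable), the three structural facts the lead's census relies on:

* `massiveBridge_schemeOffsetShift` — the `m_crit` offset shift: the regularisation with critical mass
  `m_crit(k) + a_k M / Z_m(k)` has at the tuple `m` literally the scheme of `reg` at `m + M` (the content of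
  `GradientFlowSpecies.OffsetShift`, reproved here to keep the import cone inside this route);
* `massiveBridge_speciesClusteringLaw_iff_continuumGapLaw` — along the guard `IsQCDAlong` the law is EQUIVALENT
  to its continuum form (conclusion `∃ Δ > 0, T.HasMassGap Δ`), by the Literature equivalence
  `IsQCDAlong.hasSpeciesCSClustering_iff_hasMassGap` (`MassGapToLatticeClustering`);
* `massiveBridge_speciesClusteringLaw_iff_offsetFree` — OFFSET NORMAL FORM: the law for all offsets `M₀ ≥ 0` is
  equivalent to the law for offset-free data (`∀ m > 0`, the hypothesis shape `Honest reg` of the shared cruxes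
  8922 / 8892), by the offset shift;
* `massiveBridge_speciesClusteringLaw_of_massiveLatticeGap_of_gapTransfer` — the law is implied by the shared
  items `GradientFlowSpecies.MassiveLatticeGap` (8922) ∧ `GradientFlowSpecies.GapTransfer` (8923, as typed): it
  is the honest replacement of 8923's role next to 8922.

References: Montvay–Münster 1994 §5.1 (critical hopping parameter, additive mass renormalisation); Jaffe–Witten
2000 §5; Glimm–Jaffe 1987 §6.1 Thm. 6.1.3; Osterwalder–Seiler 1978 §§2–4.
-/

noncomputable section

namespace Summit.QuantumFields.QCD.Theorems

open Filter
open Literature.MathematicalPhysics.QuantumFieldTheory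

/-- **The offset shift of a regularisation** (Montvay–Münster §5.1: the additive mass renormalisation of Wilson
fermions is flavour-blind): shifting `m_crit(k)` by `a_k M / Z_m(k)` realises the tuple `m` exactly as `reg`
realises `m + M`; every other datum of the scheme is untouched.  Definitional (`ring`).
[cite: MontvayMunster1994, §5.1] -/
theorem massiveBridge_schemeOffsetShift {Nf : ℕ} (reg : QCDRegularisation Nf) (M : ℝ) (m : Fin Nf → ℝ)
    (z shift : QCDField Nf → ℕ → ℝ) :
    ({ reg with mcrit := fun k => reg.mcrit k + reg.a k * M / reg.Zm k } : QCDRegularisation Nf).scheme m z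
        shift = reg.scheme (fun f => m f + M) z shift := by
  simp only [QCDRegularisation.scheme, QCDScheme.mk.injEq, true_and, and_true]
  funext f k
  ring

/-- The offset shift does not touch `Z_m` or `a`: mass scaling is unchanged. [cite: MontvayMunster1994, §5.1] -/
theorem massiveBridge_hasMassScaling_offsetShift_iff {Nf : ℕ} (reg : QCDRegularisation Nf) (M : ℝ) :
    ({ reg with mcrit := fun k => reg.mcrit k + reg.a k * M / reg.Zm k } : QCDRegularisation Nf).HasMassScaling ↔
      reg.HasMassScaling :=
  Iff.rfl

/-- **Species clustering law ⇔ continuum gap law.**  For `N_f ∈ {2,3}`, regularisations with `HasMassScaling`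
and full continuum data above `M₀ ≥ 0`: "above some `M₂ ≥ M₀`, every data-carrying `(z, shift, T)` has species
Cauchy–Schwarz clustering at some rate `Δ > 0`" is equivalent to "… has a continuum mass gap `T.HasMassGap Δ` at
some rate `Δ > 0`" — along a QCD scheme the lattice clustering clause IS the continuum gap clause
(`IsQCDAlong.hasSpeciesCSClustering_iff_hasMassGap`). [cite: JaffeWitten2000, §5] [cite: GlimmJaffe1987, §6.1 Thm. 6.1.3] -/
theorem massiveBridge_speciesClusteringLaw_iff_continuumGapLaw :
    (∀ Nf : ℕ, Nf = 2 ∨ Nf = 3 → ∀ (reg : QCDRegularisation Nf) (M₀ : ℝ), reg.HasMassScaling → 0 ≤ M₀ →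
      (∀ m : Fin Nf → ℝ, (∀ f, M₀ < m f) →
        ∃ (z shift : QCDField Nf → ℕ → ℝ) (T : OSData (QCDField Nf) 4),
          IsQCDAlong (reg.scheme m z shift) T ∧ T.IsNontrivial QCDField.glue ∧
            T.IsNonGaussian QCDField.glue ∧
              ∀ f g : Fin Nf, f ≠ g → T.IsNontrivial (QCDField.pseudoRe f g)) →
      ∃ M₂ : ℝ, M₀ ≤ M₂ ∧ ∀ m : Fin Nf → ℝ, (∀ f, M₂ < m f) →
        ∀ (z shift : QCDField Nf → ℕ → ℝ) (T : OSData (QCDField Nf) 4),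
          IsQCDAlong (reg.scheme m z shift) T →
            ∃ Δ : ℝ, 0 < Δ ∧ (reg.scheme m z shift).HasSpeciesCSClustering Δ) ↔
    (∀ Nf : ℕ, Nf = 2 ∨ Nf = 3 → ∀ (reg : QCDRegularisation Nf) (M₀ : ℝ), reg.HasMassScaling → 0 ≤ M₀ →
      (∀ m : Fin Nf → ℝ, (∀ f, M₀ < m f) →
        ∃ (z shift : QCDField Nf → ℕ → ℝ) (T : OSData (QCDField Nf) 4),
          IsQCDAlong (reg.scheme m z shift) T ∧ T.IsNontrivial QCDField.glue ∧
            T.IsNonGaussian QCDField.glue ∧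
              ∀ f g : Fin Nf, f ≠ g → T.IsNontrivial (QCDField.pseudoRe f g)) →
      ∃ M₂ : ℝ, M₀ ≤ M₂ ∧ ∀ m : Fin Nf → ℝ, (∀ f, M₂ < m f) →
        ∀ (z shift : QCDField Nf → ℕ → ℝ) (T : OSData (QCDField Nf) 4),
          IsQCDAlong (reg.scheme m z shift) T → ∃ Δ : ℝ, 0 < Δ ∧ T.HasMassGap Δ) := by
  constructor
  · intro h Nf hNf reg M₀ hms hM₀ hdata
    obtain ⟨M₂, hM₀₂, hm⟩ := h Nf hNf reg M₀ hms hM₀ hdata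
    refine ⟨M₂, hM₀₂, fun m hmm z shift T hqcd => ?_⟩
    obtain ⟨Δ, hΔ, hcs⟩ := hm m hmm z shift T hqcd
    exact ⟨Δ, hΔ, hqcd.hasMassGap_of_hasSpeciesCSClustering hcs⟩
  · intro h Nf hNf reg M₀ hms hM₀ hdata
    obtain ⟨M₂, hM₀₂, hm⟩ := h Nf hNf reg M₀ hms hM₀ hdata
    refine ⟨M₂, hM₀₂, fun m hmm z shift T hqcd => ?_⟩
    obtain ⟨Δ, hΔ, hgap⟩ := hm m hmm z shift T hqcd
    exact ⟨Δ, hΔ, hqcd.hasSpeciesCSClustering_of_hasMassGap hgap⟩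

/-- **Offset normal form of the species clustering law.**  The law for every offset `M₀ ≥ 0` (the shape the
crux composition consumes) is equivalent to the law for OFFSET-FREE data (`∀ m > 0`: the hypothesis shape
`Honest reg` of the shared cruxes `GradientFlowSpecies.MassiveLatticeGap` 8922 and
`HeatSlicedQuarks.RobustYangMillsHandover` 8892), with a threshold `M₂ ≥ 0`: shift `m_crit` by `a_k M₀ / Z_m(k)`
(`massiveBridge_schemeOffsetShift`). [cite: MontvayMunster1994, §5.1] [cite: JaffeWitten2000, §5] -/
theorem massiveBridge_speciesClusteringLaw_iff_offsetFree :
    (∀ Nf : ℕ, Nf = 2 ∨ Nf = 3 → ∀ (reg : QCDRegularisation Nf) (M₀ : ℝ), reg.HasMassScaling → 0 ≤ M₀ →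
      (∀ m : Fin Nf → ℝ, (∀ f, M₀ < m f) →
        ∃ (z shift : QCDField Nf → ℕ → ℝ) (T : OSData (QCDField Nf) 4),
          IsQCDAlong (reg.scheme m z shift) T ∧ T.IsNontrivial QCDField.glue ∧
            T.IsNonGaussian QCDField.glue ∧
              ∀ f g : Fin Nf, f ≠ g → T.IsNontrivial (QCDField.pseudoRe f g)) →
      ∃ M₂ : ℝ, M₀ ≤ M₂ ∧ ∀ m : Fin Nf → ℝ, (∀ f, M₂ < m f) →
        ∀ (z shift : QCDField Nf → ℕ → ℝ) (T : OSData (QCDField Nf) 4),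
          IsQCDAlong (reg.scheme m z shift) T →
            ∃ Δ : ℝ, 0 < Δ ∧ (reg.scheme m z shift).HasSpeciesCSClustering Δ) ↔
    (∀ Nf : ℕ, Nf = 2 ∨ Nf = 3 → ∀ reg : QCDRegularisation Nf, reg.HasMassScaling →
      (∀ m : Fin Nf → ℝ, (∀ f, 0 < m f) →
        ∃ (z shift : QCDField Nf → ℕ → ℝ) (T : OSData (QCDField Nf) 4),
          IsQCDAlong (reg.scheme m z shift) T ∧ T.IsNontrivial QCDField.glue ∧
            T.IsNonGaussian QCDField.glue ∧
              ∀ f g : Fin Nf, f ≠ g → T.IsNontrivial (QCDField.pseudoRe f g)) →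
      ∃ M₂ : ℝ, 0 ≤ M₂ ∧ ∀ m : Fin Nf → ℝ, (∀ f, M₂ < m f) →
        ∀ (z shift : QCDField Nf → ℕ → ℝ) (T : OSData (QCDField Nf) 4),
          IsQCDAlong (reg.scheme m z shift) T →
            ∃ Δ : ℝ, 0 < Δ ∧ (reg.scheme m z shift).HasSpeciesCSClustering Δ) := by
  constructor
  · -- specialise the offset to `M₀ = 0`
    intro h Nf hNf reg hms hdata
    exact h Nf hNf reg 0 hms le_rfl hdata
  · -- shift the offset away
    intro h Nf hNf reg M₀ hms hM₀ hdata
    set reg' : QCDRegularisation Nf :=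
      { reg with mcrit := fun k => reg.mcrit k + reg.a k * M₀ / reg.Zm k } with hreg'
    have hms' : reg'.HasMassScaling := (massiveBridge_hasMassScaling_offsetShift_iff reg M₀).2 hms
    have hdata' : ∀ m : Fin Nf → ℝ, (∀ f, 0 < m f) →
        ∃ (z shift : QCDField Nf → ℕ → ℝ) (T : OSData (QCDField Nf) 4),
          IsQCDAlong (reg'.scheme m z shift) T ∧ T.IsNontrivial QCDField.glue ∧
            T.IsNonGaussian QCDField.glue ∧
              ∀ f g : Fin Nf, f ≠ g → T.IsNontrivial (QCDField.pseudoRe f g) := by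
      intro m hm
      obtain ⟨z, shift, T, hqcd, hglue, hng, hps⟩ := hdata (fun f => m f + M₀) fun f => by
        have := hm f; linarith
      refine ⟨z, shift, T, ?_, hglue, hng, hps⟩
      rwa [hreg', massiveBridge_schemeOffsetShift reg M₀ m z shift]
    obtain ⟨M₂, hM₂, hm⟩ := h Nf hNf reg' hms' hdata'
    refine ⟨M₂ + M₀, by linarith, fun m hmm z shift T hqcd => ?_⟩
    have hmm' : ∀ f, M₂ < (fun f => m f - M₀) f := fun f => by
      have := hmm f; simp only; linarith
    have hsch : reg'.scheme (fun f => m f - M₀) z shift = reg.scheme m z shift := by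
      rw [hreg', massiveBridge_schemeOffsetShift reg M₀ (fun f => m f - M₀) z shift]
      simp only [sub_add_cancel]
    have hqcd' : IsQCDAlong (reg'.scheme (fun f => m f - M₀) z shift) T := by rwa [hsch]
    obtain ⟨Δ, hΔ, hcs⟩ := hm (fun f => m f - M₀) hmm' z shift T hqcd'
    exact ⟨Δ, hΔ, by rwa [hsch] at hcs⟩

/-- **Where the law sits among the shared items**: the species clustering law (inlined) FOLLOWS from the
shared lattice gap law `GradientFlowSpecies.MassiveLatticeGap` (stmt-QuantumFields-8922) together with the
shared transfer item `GradientFlowSpecies.GapTransfer` (stmt-QuantumFields-8923, as typed): the lattice gap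
`Δ` above 8922's threshold is transferred to `T.HasMassGap (Δ/2)` along any data-carrying `(z, shift, T)`
(the lattice clause does not read `z, shift`), and the continuum gap is read back on the lattice as species
Cauchy–Schwarz clustering (`IsQCDAlong.hasSpeciesCSClustering_of_hasMassGap`).  So the law is at most the
conjunction 8922 ∧ 8923 — and it is the honest replacement of 8923's role in that conjunction (8923's
per-pair hypothesis is not expected to transfer; the law asks the species clustering directly).
[cite: JaffeWitten2000, §5] [cite: OsterwalderSeiler1978, §§2–4] -/
theorem massiveBridge_speciesClusteringLaw_of_massiveLatticeGap_of_gapTransfer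
    (hML : Summit.QuantumFields.QCD.Theses.GradientFlowSpecies.MassiveLatticeGap)
    (hGT : Summit.QuantumFields.QCD.Theses.GradientFlowSpecies.GapTransfer) :
    ∀ Nf : ℕ, Nf = 2 ∨ Nf = 3 → ∀ (reg : QCDRegularisation Nf) (M₀ : ℝ), reg.HasMassScaling → 0 ≤ M₀ →
      (∀ m : Fin Nf → ℝ, (∀ f, M₀ < m f) →
        ∃ (z shift : QCDField Nf → ℕ → ℝ) (T : OSData (QCDField Nf) 4),
          IsQCDAlong (reg.scheme m z shift) T ∧ T.IsNontrivial QCDField.glue ∧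
            T.IsNonGaussian QCDField.glue ∧
              ∀ f g : Fin Nf, f ≠ g → T.IsNontrivial (QCDField.pseudoRe f g)) →
      ∃ M₂ : ℝ, M₀ ≤ M₂ ∧ ∀ m : Fin Nf → ℝ, (∀ f, M₂ < m f) →
        ∀ (z shift : QCDField Nf → ℕ → ℝ) (T : OSData (QCDField Nf) 4),
          IsQCDAlong (reg.scheme m z shift) T →
            ∃ Δ : ℝ, 0 < Δ ∧ (reg.scheme m z shift).HasSpeciesCSClustering Δ := by
  refine massiveBridge_speciesClusteringLaw_iff_offsetFree.2 fun Nf hNf reg hms hdata => ?_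
  obtain ⟨M, hM⟩ := hML Nf hNf reg ⟨hms, hdata⟩
  refine ⟨max M 0, le_max_right _ _, fun m hm z shift T hqcd => ?_⟩
  obtain ⟨Δ, hΔ, hlat⟩ := hM m fun f => (le_max_left M 0).trans_lt (hm f)
  have hlat' : (reg.scheme m z shift).HasLatticeMassGap Δ := hlat
  have hgap : T.HasMassGap (Δ / 2) :=
    hGT Nf (reg.scheme m z shift) T Δ (Δ / 2) (by positivity) (by linarith) hqcd hlat'
  exact ⟨Δ / 2, by positivity, hqcd.hasSpeciesCSClustering_of_hasMassGap hgap⟩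

end Summit.QuantumFields.QCD.Theorems

end
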